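import Summits.QuantumFields.BalabanUV.T4Continuum.Support.NE7WhitneyLiftAverage
import Summits.QuantumFields.BalabanUV.T4Continuum.Support.NE3SmoothRightInverseBounds
import HarnessLib

/-!
# NE7WhitneyLiftDefect — THE DEFECT `cpush_1 (Wφ) − φ` OF THE WHITNEY-TYPE LIFT IS CONTROLLED BY THE OSCILLATION OF THE DATUM: translation covariance, the frame piece
# `F̂(Wφ)(M•y) − F̂(Wφ)(M•y + M•e_κ) = −F̂(W(∇_κ φ))(M•y)`, and the `ℓ²` letters of both pieces against the corner oscillation `Σ_{y,T,j} ‖φ(y + 𝟙_T) j − φ y j‖²`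
# (lineage `b2b-balaban-t4-ne7b-p1`, gen 162; route (H′) of `t4/b2b-balaban-t4-ne7b-p1/g162/records/SCOPING-LEVELMASSES.md` §3: the defect feeds the GRADIENT channel of the recursion)

Cell `pub-balaban`, rung (B)+1 sub-cell t4, lineage `b2b-balaban-t4-ne7b-p1` (row NE7b OWNER + CRUX PROVER; junction service for row NE7 on ROAD-G116 §6 (G3) ∕ ROAD-G117 §4 (S1)),
generation 162; sequel of ✓ `NE7WhitneyLiftFlat` (W1a) and ✓ `NE7WhitneyLiftAverage` (W1b: `cpush M 1 (Wφ) y κ = (F̂(Wφ)(M•y) − F̂(Wφ)(M•y + M•e_κ)) + interpCore univ (φ(·,κ)) y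
(const (M−1)∕(2M))`, exact on gauge directions).  The lift `W φ (z,κ) := (M:ℝ)⁻¹ • interp M (univ∖{κ}) (φ(·,κ)) z` is written out; no `def`.
WHAT ([folklore]; 0 def, 0 sorry; every `d`):
§1 TRANSLATION COVARIANCE: `interp_add_smul_site` (`interp M S G (x + M•v) = interp M S (G(·+v)) x`), `Fhat_whitneyLift_translate`, `Fhat_sub'`, and **`frameDefect_eq_neg_Fhat_cfd`**:
   `F̂(Wφ)(M•y) − F̂(Wφ)(M•y + M•e_κ) = −F̂(W(∇_κ φ))(M•y)` — the frame piece of the defect is the frame functional of the lift of the coarse FORWARD DIFFERENCE;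
§2 BLOCK LETTERS: `blk_eq_of_box` (bonds of the box `[M•y, M•y + (M−1)]` lie in block `y`), `norm_sq_whitneyLift_le_corners` (`‖Wψ(u,j)‖² ≤ M^{−2}·Σ_T ‖ψ(y+𝟙_T, j)‖²` on block `y`),
   **`norm_sq_Fhat_whitneyLift_le`** (`‖F̂(Wψ)(M•y)‖² ≤ d²·Σ_j Σ_T ‖ψ(y+𝟙_T, j)‖²`, over row NE3's ✓ `NE3SmoothRightInverseBounds.norm_Fhat_le_of_block`);
§3 THE `ℓ²` LETTERS (φ `N`-periodic, `M, N ≥ 1`): **`sum_norm_sq_frameDefect_le`** (`Σ_{y∈[0,N)^d} ‖frame piece (y,κ)‖² ≤ d²·2^d·Σ_y Σ_j ‖∇_κ φ_j (y)‖²`),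
   **`sum_norm_sq_stencilDefect_le`** (`Σ_y ‖interpCore univ (φ(·,κ)) y (const c) − φ(y,κ)‖² ≤ Σ_y Σ_{T⊆univ} ‖φ(y+𝟙_T,κ) − φ(y,κ)‖²`, `0 ≤ c ≤ 1`; Jensen of W1a on the differences),
   and the headline **`sum_norm_sq_whitneyDefect_le`**:
   `Σ_{y∈[0,N)^d} Σ_κ ‖cpush M 1 (Wφ) y κ − φ y κ‖² ≤ 2·(d²·2^d + 1)·Σ_y Σ_j Σ_{T⊆univ} ‖φ(y + 𝟙_T) j − φ y j‖²` — the defect of the one-step flat linearised average on the lift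
   is controlled by the CORNER OSCILLATION of the datum (no zero-order term; W1b: it vanishes identically on gauge directions).
WHAT IS NOT HERE: the reduction of the corner oscillation to the unit gradient energy (a factor `d·2^d`, cf. ✓ `NE7HomogeneousLiftFlat.sum_nhsNormSq_defect_le`), the curved transport,
the exact corrected lift `W − gaugeDir(F̃) + R((1−S)·)` of the memo (row NE3's ✓ `rightInvW` on the stencil defect).
HONEST FRAMING (page 1): flat lattice kinematics of OUR lift; nothing of Bałaban's asserted ([Balaban1985Averaging] (42), (47)–(48), (110)–(125) context only); NOT (G3), NOT (G), NOT NE7∕NE3 as spine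
nodes; row NE7b NOT PRINTED ∕ NOT PROVED; spine 0∕9; finite T⁴ rung (B)+1 — NOT infinite volume, NOT mass gap, NOT BetaPertH, NOT Clay.
-/

set_option autoImplicit false

open scoped BigOperators Matrix Matrix.Norms.L2Operator
open Finset

namespace Summit.QuantumFields.BalabanUV.T4Continuum.NE7WhitneyLiftDefect

open Literature.MathematicalPhysics.QuantumFieldTheory.Balaban1983to89
open B7Prop1Explicit B7Prop2Explicit
open T4AveragingDeficitWall (IsSkewDir dirSq)
open T4AveragingDeficitWallBoundary (periodBox mem_periodBox sum_periodBox_shift)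
open AveragingDeficitMultiLevelPrep (cpush)
open B7Prop3Flat (Fhat linQ)
open MinimalActionWitness (flatCfg)
open SmoothRefineBlocks (blk res blk_res_eq_of blk_add_res)
open SmoothRefineInterp (interp interpCore indic cfd wt wt_nonneg wt_le_one interp_sub interpCore_shift interpCore_const interpCore_sub)
open SmoothRefineNeutral (asum_sub)
open NE3TangentFlatStructure (Fhat_shift)
open NE3SmoothRightInverseBounds (norm_Fhat_le_of_block)
open NE7InterpolationLiftCurl (sum_periodBox_sum_indic)
open NE7WhitneyLiftFlat (norm_sq_interpCore_le interpCore_real_le_sum)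
open NE7WhitneyLiftAverage (cpush_flatCfg_whitneyLift interpCore_const_weights_sub_self)

noncomputable section

variable {d : ℕ} {n : Type*} [Fintype n] [DecidableEq n]

/-! ## §1 Translation covariance and the frame piece of the defect -/

section Translate

variable {X : Type*} [AddCommGroup X] [Module ℝ X]

omit [Fintype n] [DecidableEq n] in
/-- Translating the fine site by a coarse vector translates the datum: `interp M S G (x + M•v) = interp M S (G(·+v)) x` (`M ≥ 1`). [folklore] -/
theorem interp_add_smul_site {M : ℕ} (hM : 1 ≤ M) (S : Finset (Fin d)) (G : Site d → X) (x v : Site d) :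
    interp M S G (x + (M : ℤ) • v) = interp M S (fun y => G (y + v)) x := by
  have hbr := blk_res_eq_of (L := M) hM (y := x + (M : ℤ) • v) (z := blk M x + v) (ρ := res M x)
    (by rw [smul_add, add_right_comm, blk_add_res]) (SmoothRefineBlocks.res_nonneg hM x) (SmoothRefineBlocks.res_lt hM x)
  unfold interp
  have hw : wt M (x + (M : ℤ) • v) = wt M x := by funext i; simp only [wt, hbr.2]
  rw [hw, hbr.1, interpCore_shift]

end Translate

/-- `Fhat` is additive: subtraction. [folklore] -/
theorem Fhat_sub' (L : ℕ) (A B : Site d → Fin d → Matrix n n ℂ) (q : Site d) :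
    Fhat L (fun y μ => A y μ - B y μ) q = Fhat L A q - Fhat L B q := by
  unfold Fhat
  rw [← Finset.sum_sub_distrib]
  refine Finset.sum_congr rfl fun r _ => ?_
  rw [asum_sub, smul_sub]

/-- Translation covariance of the frame functional of the lift: `F̂(Wφ)(q + M•v) = F̂(W(φ(·+v)))(q)` (`M ≥ 1`). [folklore] -/
theorem Fhat_whitneyLift_translate {M : ℕ} (hM : 1 ≤ M) (φ : Site d → Fin d → Matrix n n ℂ) (q v : Site d) :
    Fhat M (fun z κ' => ((M : ℝ)⁻¹) • interp M (Finset.univ.erase κ') (fun w => φ w κ') z) (q + (M : ℤ) • v)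
      = Fhat M (fun z κ' => ((M : ℝ)⁻¹) • interp M (Finset.univ.erase κ') (fun w => φ (w + v) κ') z) q := by
  rw [← Fhat_shift]
  congr 1
  funext z κ'
  rw [interp_add_smul_site hM]

/-- **THE FRAME PIECE OF THE DEFECT IS THE FRAME FUNCTIONAL OF THE LIFT OF THE FORWARD DIFFERENCE** (`M ≥ 1`):
`F̂(Wφ)(M•y) − F̂(Wφ)(M•y + M•e_κ) = −F̂(W(∇_κ φ))(M•y)`, `(∇_κ φ)(w, j) = φ(w + e_κ) j − φ w j`. [folklore] -/
theorem frameDefect_eq_neg_Fhat_cfd {M : ℕ} (hM : 1 ≤ M) (φ : Site d → Fin d → Matrix n n ℂ) (y : Site d) (κ : Fin d) :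
    Fhat M (fun z κ' => ((M : ℝ)⁻¹) • interp M (Finset.univ.erase κ') (fun w => φ w κ') z) ((M : ℤ) • y)
        - Fhat M (fun z κ' => ((M : ℝ)⁻¹) • interp M (Finset.univ.erase κ') (fun w => φ w κ') z) ((M : ℤ) • y + (M : ℤ) • e κ)
      = -Fhat M (fun z κ' => ((M : ℝ)⁻¹) • interp M (Finset.univ.erase κ') (fun w => φ (w + e κ) κ' - φ w κ') z) ((M : ℤ) • y) := by
  rw [Fhat_whitneyLift_translate hM]
  have hC : Fhat M (fun z κ' => ((M : ℝ)⁻¹) • interp M (Finset.univ.erase κ') (fun w => φ (w + e κ) κ' - φ w κ') z) ((M : ℤ) • y)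
      = Fhat M (fun z κ' => ((M : ℝ)⁻¹) • interp M (Finset.univ.erase κ') (fun w => φ (w + e κ) κ') z) ((M : ℤ) • y)
        - Fhat M (fun z κ' => ((M : ℝ)⁻¹) • interp M (Finset.univ.erase κ') (fun w => φ w κ') z) ((M : ℤ) • y) := by
    rw [← Fhat_sub']
    congr 1
    funext z κ'
    rw [← smul_sub, ← interp_sub]
  rw [hC]
  abel

/-! ## §2 Block letters: the lift and its frame functional on one block -/

omit [Fintype n] [DecidableEq n] in
/-- Bonds of the box `[M•y, M•y + (M−1)]` lie in block `y`. [folklore] -/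
theorem blk_eq_of_box {M : ℕ} (hM : 1 ≤ M) {y u : Site d} (hqu : (M : ℤ) • y ≤ u) (hu : ∀ i, u i ≤ ((M : ℤ) • y) i + ((M : ℤ) - 1)) :
    blk M u = y := by
  refine (blk_res_eq_of (L := M) hM (y := u) (z := y) (ρ := u - (M : ℤ) • y) (by abel) (fun i => ?_) (fun i => ?_)).1
  · have := hqu i; simp only [Pi.sub_apply]; linarith
  · have := hu i; simp only [Pi.sub_apply, Pi.smul_apply, smul_eq_mul] at this ⊢; linarith

/-- **THE LIFT ON ONE BLOCK AGAINST THE CORNERS** (`M ≥ 1`): for `blk M u = y`, `‖Wψ(u, j)‖² ≤ M^{−2}·Σ_{T⊆univ∖{j}} ‖ψ(y + 𝟙_T, j)‖²` (Jensen, weights `≤ 1`). [folklore] -/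
theorem norm_sq_whitneyLift_le_corners {M : ℕ} (hM : 1 ≤ M) (ψ : Site d → Fin d → Matrix n n ℂ) {u y : Site d} (hu : blk M u = y) (j : Fin d) :
    ‖((M : ℝ)⁻¹) • interp M (Finset.univ.erase j) (fun w => ψ w j) u‖ ^ 2 ≤ ((M : ℝ) ^ 2)⁻¹ * ∑ T ∈ (Finset.univ.erase j).powerset, ‖ψ (y + indic T) j‖ ^ 2 := by
  have hM0 : (0 : ℝ) < M := by exact_mod_cast (by omega : 0 < M)
  rw [norm_smul, norm_inv, Real.norm_of_nonneg hM0.le, mul_pow, inv_pow]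
  refine mul_le_mul_of_nonneg_left ?_ (by positivity)
  unfold interp
  rw [hu]
  refine (norm_sq_interpCore_le _ (wt_nonneg hM u) (wt_le_one hM u) _ y).trans ?_
  exact interpCore_real_le_sum _ (wt_nonneg hM u) (wt_le_one hM u) (fun w => by positivity) y

/-- **THE FRAME FUNCTIONAL OF THE LIFT ON ONE BLOCK** (`M ≥ 1`): `‖F̂(Wψ)(M•y)‖² ≤ d²·Σ_j Σ_{T⊆univ} ‖ψ(y + 𝟙_T, j)‖²` — every tree contour has at most `d(M−1)` bonds, each carrying
`≤ M⁻¹·√(Σ_{j,T} ‖ψ(y+𝟙_T,j)‖²)` (row NE3's ✓ `norm_Fhat_le_of_block`). [folklore] -/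
theorem norm_sq_Fhat_whitneyLift_le {M : ℕ} (hM : 1 ≤ M) (ψ : Site d → Fin d → Matrix n n ℂ) (y : Site d) :
    ‖Fhat M (fun z κ' => ((M : ℝ)⁻¹) • interp M (Finset.univ.erase κ') (fun w => ψ w κ') z) ((M : ℤ) • y)‖ ^ 2
      ≤ (d : ℝ) ^ 2 * ∑ j : Fin d, ∑ T ∈ (Finset.univ : Finset (Fin d)).powerset, ‖ψ (y + indic T) j‖ ^ 2 := by
  have hM0 : (0 : ℝ) < M := by exact_mod_cast (by omega : 0 < M)
  set Q : ℝ := ∑ j : Fin d, ∑ T ∈ (Finset.univ : Finset (Fin d)).powerset, ‖ψ (y + indic T) j‖ ^ 2 with hQ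
  have hQ0 : 0 ≤ Q := Finset.sum_nonneg fun _ _ => Finset.sum_nonneg fun _ _ => sq_nonneg _
  set b : ℝ := ((M : ℝ))⁻¹ * Real.sqrt Q with hb
  have hb0 : 0 ≤ b := by positivity
  -- every bond of the box carries `≤ b`
  have hV : ∀ (u : Site d) (j : Fin d), (M : ℤ) • y ≤ u → (∀ i, (u + e j) i ≤ ((M : ℤ) • y) i + ((M : ℤ) - 1)) →
      ‖(fun z κ' => ((M : ℝ)⁻¹) • interp M (Finset.univ.erase κ') (fun w => ψ w κ') z) u j‖ ≤ b := by
    intro u j hqu hu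
    have hu' : ∀ i, u i ≤ ((M : ℤ) • y) i + ((M : ℤ) - 1) := fun i => by
      have h := hu i
      simp only [Pi.add_apply, e_apply] at h
      split_ifs at h <;> linarith
    have hblk := blk_eq_of_box hM hqu hu'
    have h1 := norm_sq_whitneyLift_le_corners hM ψ hblk j
    have h2 : ∑ T ∈ (Finset.univ.erase j).powerset, ‖ψ (y + indic T) j‖ ^ 2 ≤ Q := by
      rw [hQ]
      refine le_trans ?_ (Finset.single_le_sum (f := fun j' => ∑ T ∈ (Finset.univ : Finset (Fin d)).powerset, ‖ψ (y + indic T) j'‖ ^ 2)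
        (fun _ _ => Finset.sum_nonneg fun _ _ => sq_nonneg _) (Finset.mem_univ j))
      exact Finset.sum_le_sum_of_subset_of_nonneg (Finset.powerset_mono.mpr (Finset.subset_univ _)) fun _ _ _ => sq_nonneg _
    have h3 : ‖(fun z κ' => ((M : ℝ)⁻¹) • interp M (Finset.univ.erase κ') (fun w => ψ w κ') z) u j‖ ^ 2 ≤ b ^ 2 := by
      show ‖((M : ℝ)⁻¹) • interp M (Finset.univ.erase j) (fun w => ψ w j) u‖ ^ 2 ≤ b ^ 2
      rw [hb, mul_pow, Real.sq_sqrt hQ0, inv_pow]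
      exact h1.trans (mul_le_mul_of_nonneg_left h2 (by positivity))
    exact (sq_le_sq₀ (norm_nonneg _) hb0).mp h3
  have hF := norm_Fhat_le_of_block hM _ ((M : ℤ) • y) hb0 hV
  -- square it
  have hdM : (d : ℝ) * (((M : ℝ)) - 1) * b ≤ (d : ℝ) * Real.sqrt Q := by
    rw [hb, mul_assoc]
    refine mul_le_mul_of_nonneg_left ?_ (Nat.cast_nonneg d)
    rw [← mul_assoc]
    have : (((M : ℝ)) - 1) * ((M : ℝ))⁻¹ ≤ 1 := by
      rw [sub_mul, mul_inv_cancel₀ hM0.ne']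
      have : 0 ≤ ((M : ℝ))⁻¹ := by positivity
      linarith
    exact (mul_le_of_le_one_left (Real.sqrt_nonneg _) this)
  have h4 := hF.trans hdM
  calc ‖Fhat M (fun z κ' => ((M : ℝ)⁻¹) • interp M (Finset.univ.erase κ') (fun w => ψ w κ') z) ((M : ℤ) • y)‖ ^ 2
      ≤ ((d : ℝ) * Real.sqrt Q) ^ 2 := pow_le_pow_left₀ (norm_nonneg _) h4 2
    _ = (d : ℝ) ^ 2 * Q := by rw [mul_pow, Real.sq_sqrt hQ0]

/-! ## §3 The `ℓ²` letters of the defect -/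

/-- **THE FRAME PIECE IN `ℓ²`** (`M, N ≥ 1`, `φ` `N`-periodic):
`Σ_{y∈[0,N)^d} ‖F̂(Wφ)(M•y) − F̂(Wφ)(M•y + M•e_κ)‖² ≤ d²·2^d·Σ_{y∈[0,N)^d} Σ_j ‖φ(y + e_κ) j − φ y j‖²`. [folklore] -/
theorem sum_norm_sq_frameDefect_le {M : ℕ} (hM : 1 ≤ M) {N : ℕ} (hN : 1 ≤ N) {φ : Site d → Fin d → Matrix n n ℂ}
    (hφ : ∀ (z : Site d) (τ κ : Fin d), φ (z + (N : ℤ) • e τ) κ = φ z κ) (κ : Fin d) :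
    ∑ y ∈ periodBox (d := d) N, ‖Fhat M (fun z κ' => ((M : ℝ)⁻¹) • interp M (Finset.univ.erase κ') (fun w => φ w κ') z) ((M : ℤ) • y)
        - Fhat M (fun z κ' => ((M : ℝ)⁻¹) • interp M (Finset.univ.erase κ') (fun w => φ w κ') z) ((M : ℤ) • y + (M : ℤ) • e κ)‖ ^ 2
      ≤ (d : ℝ) ^ 2 * 2 ^ d * ∑ y ∈ periodBox (d := d) N, ∑ j : Fin d, ‖φ (y + e κ) j - φ y j‖ ^ 2 := by
  set ψ : Site d → Fin d → Matrix n n ℂ := fun w j => φ (w + e κ) j - φ w j with hψ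
  have hψP : ∀ (z : Site d) (τ : Fin d), (fun w => ∑ j : Fin d, ‖ψ w j‖ ^ 2) (z + (N : ℤ) • e τ) = (fun w => ∑ j : Fin d, ‖ψ w j‖ ^ 2) z := by
    intro z τ
    simp only [hψ, add_right_comm _ ((N : ℤ) • e τ), hφ]
  calc ∑ y ∈ periodBox (d := d) N, ‖Fhat M (fun z κ' => ((M : ℝ)⁻¹) • interp M (Finset.univ.erase κ') (fun w => φ w κ') z) ((M : ℤ) • y)
          - Fhat M (fun z κ' => ((M : ℝ)⁻¹) • interp M (Finset.univ.erase κ') (fun w => φ w κ') z) ((M : ℤ) • y + (M : ℤ) • e κ)‖ ^ 2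
      = ∑ y ∈ periodBox (d := d) N, ‖Fhat M (fun z κ' => ((M : ℝ)⁻¹) • interp M (Finset.univ.erase κ') (fun w => ψ w κ') z) ((M : ℤ) • y)‖ ^ 2 := by
        refine Finset.sum_congr rfl fun y _ => ?_
        rw [frameDefect_eq_neg_Fhat_cfd hM, norm_neg, hψ]
    _ ≤ ∑ y ∈ periodBox (d := d) N, (d : ℝ) ^ 2 * ∑ j : Fin d, ∑ T ∈ (Finset.univ : Finset (Fin d)).powerset, ‖ψ (y + indic T) j‖ ^ 2 :=
        Finset.sum_le_sum fun y _ => norm_sq_Fhat_whitneyLift_le hM ψ y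
    _ = (d : ℝ) ^ 2 * ∑ y ∈ periodBox (d := d) N, ∑ T ∈ (Finset.univ : Finset (Fin d)).powerset, ∑ j : Fin d, ‖ψ (y + indic T) j‖ ^ 2 := by
        rw [Finset.mul_sum]
        refine Finset.sum_congr rfl fun y _ => ?_
        rw [Finset.sum_comm]
    _ = (d : ℝ) ^ 2 * (2 ^ d * ∑ y ∈ periodBox (d := d) N, ∑ j : Fin d, ‖ψ y j‖ ^ 2) := by
        have hci := sum_periodBox_sum_indic hN (g := fun w => ∑ j : Fin d, ‖ψ w j‖ ^ 2) hψP
        rw [hci]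
    _ = (d : ℝ) ^ 2 * 2 ^ d * ∑ y ∈ periodBox (d := d) N, ∑ j : Fin d, ‖φ (y + e κ) j - φ y j‖ ^ 2 := by rw [hψ]; ring

/-- **THE STENCIL PIECE, POINTWISE** (`0 ≤ c ≤ 1`): `‖interpCore S G y (const c) − G y‖² ≤ Σ_{T⊆S} ‖G(y + 𝟙_T) − G y‖²` (no zero-order term; Jensen on the differences). [folklore] -/
theorem norm_sq_stencilDefect_le {X : Type*} [NormedAddCommGroup X] [NormedSpace ℝ X] (S : Finset (Fin d)) (G : Site d → X) (y : Site d)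
    {c : ℝ} (hc0 : 0 ≤ c) (hc1 : c ≤ 1) :
    ‖interpCore S G y (fun _ => c) - G y‖ ^ 2 ≤ ∑ T ∈ S.powerset, ‖G (y + indic T) - G y‖ ^ 2 := by
  have h1 : interpCore S G y (fun _ => c) - G y = interpCore S (fun x => G x - G y) y (fun _ => c) := by
    rw [interpCore_sub, interpCore_const]
  rw [h1]
  refine (norm_sq_interpCore_le S (fun _ => hc0) (fun _ => hc1) _ y).trans ?_
  exact interpCore_real_le_sum S (fun _ => hc0) (fun _ => hc1) (fun _ => by positivity) y

/-- **THE STENCIL PIECE IN `ℓ²`**: `Σ_y ‖interpCore univ (φ(·,κ)) y (const (M−1)∕(2M)) − φ(y,κ)‖² ≤ Σ_y Σ_{T⊆univ} ‖φ(y+𝟙_T,κ) − φ(y,κ)‖²` (`M ≥ 1`). [folklore] -/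
theorem sum_norm_sq_stencilDefect_le {M : ℕ} (hM : 1 ≤ M) (φ : Site d → Fin d → Matrix n n ℂ) (F : Finset (Site d)) (κ : Fin d) :
    ∑ y ∈ F, ‖interpCore Finset.univ (fun w => φ w κ) y (fun _ => (((M : ℝ)) - 1) / (2 * M)) - φ y κ‖ ^ 2
      ≤ ∑ y ∈ F, ∑ T ∈ (Finset.univ : Finset (Fin d)).powerset, ‖φ (y + indic T) κ - φ y κ‖ ^ 2 := by
  have hM1 : (1 : ℝ) ≤ M := by exact_mod_cast hM
  have hc0 : 0 ≤ (((M : ℝ)) - 1) / (2 * M) := by apply div_nonneg <;> linarith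
  have hc1 : (((M : ℝ)) - 1) / (2 * M) ≤ 1 := by rw [div_le_one (by linarith)]; linarith
  exact Finset.sum_le_sum fun y _ => norm_sq_stencilDefect_le _ _ y hc0 hc1

/-- Singletons inside the corner oscillation: `Σ_j ‖φ(y + e_κ) j − φ y j‖² ≤ Σ_j Σ_{T⊆univ} ‖φ(y + 𝟙_T) j − φ y j‖²`. [folklore] -/
theorem sum_norm_sq_cfd_le_corner (φ : Site d → Fin d → Matrix n n ℂ) (y : Site d) (κ : Fin d) :
    ∑ j : Fin d, ‖φ (y + e κ) j - φ y j‖ ^ 2 ≤ ∑ j : Fin d, ∑ T ∈ (Finset.univ : Finset (Fin d)).powerset, ‖φ (y + indic T) j - φ y j‖ ^ 2 := by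
  refine Finset.sum_le_sum fun j _ => ?_
  have hmem : ({κ} : Finset (Fin d)) ∈ (Finset.univ : Finset (Fin d)).powerset := Finset.mem_powerset.mpr (Finset.subset_univ _)
  have hind : indic ({κ} : Finset (Fin d)) = e κ := by simp [indic]
  refine le_trans ?_ (Finset.single_le_sum (f := fun T => ‖φ (y + indic T) j - φ y j‖ ^ 2) (fun _ _ => sq_nonneg _) hmem)
  rw [hind]

/-- **THE DEFECT OF THE ONE-STEP FLAT LINEARISED AVERAGE ON THE LIFT AGAINST THE CORNER OSCILLATION OF THE DATUM** (`M, N ≥ 1`, `φ` `N`-periodic):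
`Σ_{y∈[0,N)^d} Σ_κ ‖cpush M 1 (Wφ) y κ − φ y κ‖² ≤ 2·(d²·2^d + 1)·Σ_{y∈[0,N)^d} Σ_j Σ_{T⊆univ} ‖φ(y + 𝟙_T) j − φ y j‖²`. [folklore] -/
theorem sum_norm_sq_whitneyDefect_le {M : ℕ} (hM : 1 ≤ M) {N : ℕ} (hN : 1 ≤ N) {φ : Site d → Fin d → Matrix n n ℂ}
    (hφ : ∀ (z : Site d) (τ κ : Fin d), φ (z + (N : ℤ) • e τ) κ = φ z κ) :
    ∑ y ∈ periodBox (d := d) N, ∑ κ : Fin d,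
        ‖cpush M (flatCfg (d := d) (n := n)) (fun z κ' => ((M : ℝ)⁻¹) • interp M (Finset.univ.erase κ') (fun w => φ w κ') z) y κ - φ y κ‖ ^ 2
      ≤ 2 * ((d : ℝ) ^ 2 * 2 ^ d + 1) * ∑ y ∈ periodBox (d := d) N, ∑ j : Fin d, ∑ T ∈ (Finset.univ : Finset (Fin d)).powerset, ‖φ (y + indic T) j - φ y j‖ ^ 2 := by
  -- abbreviations for the two pieces
  set Fr : Site d → Fin d → Matrix n n ℂ := fun y κ =>
    Fhat M (fun z κ' => ((M : ℝ)⁻¹) • interp M (Finset.univ.erase κ') (fun w => φ w κ') z) ((M : ℤ) • y)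
      - Fhat M (fun z κ' => ((M : ℝ)⁻¹) • interp M (Finset.univ.erase κ') (fun w => φ w κ') z) ((M : ℤ) • y + (M : ℤ) • e κ) with hFr
  set St : Site d → Fin d → Matrix n n ℂ := fun y κ => interpCore Finset.univ (fun w => φ w κ) y (fun _ => (((M : ℝ)) - 1) / (2 * M)) - φ y κ with hSt
  set Osc : ℝ := ∑ y ∈ periodBox (d := d) N, ∑ j : Fin d, ∑ T ∈ (Finset.univ : Finset (Fin d)).powerset, ‖φ (y + indic T) j - φ y j‖ ^ 2 with hOsc
  -- pointwise: defect = Fr + St, `‖Fr + St‖² ≤ 2‖Fr‖² + 2‖St‖²`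
  have hpt : ∀ (y : Site d) (κ : Fin d),
      ‖cpush M (flatCfg (d := d) (n := n)) (fun z κ' => ((M : ℝ)⁻¹) • interp M (Finset.univ.erase κ') (fun w => φ w κ') z) y κ - φ y κ‖ ^ 2
        ≤ 2 * ‖Fr y κ‖ ^ 2 + 2 * ‖St y κ‖ ^ 2 := by
    intro y κ
    have e1 : cpush M (flatCfg (d := d) (n := n)) (fun z κ' => ((M : ℝ)⁻¹) • interp M (Finset.univ.erase κ') (fun w => φ w κ') z) y κ - φ y κ
        = Fr y κ + St y κ := by
      rw [cpush_flatCfg_whitneyLift hM]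
      simp only [hFr, hSt]
      abel
    rw [e1]
    have h := norm_add_le (Fr y κ) (St y κ)
    have h2 : ‖Fr y κ + St y κ‖ ^ 2 ≤ (‖Fr y κ‖ + ‖St y κ‖) ^ 2 := pow_le_pow_left₀ (norm_nonneg _) h 2
    nlinarith [sq_nonneg (‖Fr y κ‖ - ‖St y κ‖)]
  -- the two `ℓ²` letters
  have hFrSum : ∑ y ∈ periodBox (d := d) N, ∑ κ : Fin d, ‖Fr y κ‖ ^ 2 ≤ (d : ℝ) ^ 2 * 2 ^ d * Osc := by
    rw [Finset.sum_comm]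
    calc ∑ κ : Fin d, ∑ y ∈ periodBox (d := d) N, ‖Fr y κ‖ ^ 2
        ≤ ∑ κ : Fin d, (d : ℝ) ^ 2 * 2 ^ d * ∑ y ∈ periodBox (d := d) N, ∑ j : Fin d, ‖φ (y + e κ) j - φ y j‖ ^ 2 :=
          Finset.sum_le_sum fun κ _ => sum_norm_sq_frameDefect_le hM hN hφ κ
      _ = (d : ℝ) ^ 2 * 2 ^ d * ∑ y ∈ periodBox (d := d) N, ∑ κ : Fin d, ∑ j : Fin d, ‖φ (y + e κ) j - φ y j‖ ^ 2 := by
          rw [← Finset.mul_sum, Finset.sum_comm]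
      _ ≤ (d : ℝ) ^ 2 * 2 ^ d * Osc := by
          refine mul_le_mul_of_nonneg_left ?_ (by positivity)
          rw [hOsc]
          refine Finset.sum_le_sum fun y _ => ?_
          -- `Σ_κ Σ_j ‖∇_κ φ_j‖² ≤ Σ_j Σ_T ‖φ(y+𝟙_T) j − φ y j‖²`: every `κ` contributes the singleton `T = {κ}` … but the singletons are DISTINCT over `κ`
          calc ∑ κ : Fin d, ∑ j : Fin d, ‖φ (y + e κ) j - φ y j‖ ^ 2
              = ∑ j : Fin d, ∑ κ : Fin d, ‖φ (y + indic ({κ} : Finset (Fin d))) j - φ y j‖ ^ 2 := by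
                rw [Finset.sum_comm]
                refine Finset.sum_congr rfl fun j _ => Finset.sum_congr rfl fun κ _ => ?_
                have hind : indic ({κ} : Finset (Fin d)) = e κ := by simp [indic]
                rw [hind]
            _ ≤ ∑ j : Fin d, ∑ T ∈ (Finset.univ : Finset (Fin d)).powerset, ‖φ (y + indic T) j - φ y j‖ ^ 2 := by
                refine Finset.sum_le_sum fun j _ => ?_
                rw [← Finset.sum_image (f := fun T : Finset (Fin d) => ‖φ (y + indic T) j - φ y j‖ ^ 2)
                  (s := (Finset.univ : Finset (Fin d))) (g := fun κ : Fin d => ({κ} : Finset (Fin d)))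
                  (fun a _ b _ h => Finset.singleton_injective h)]
                exact Finset.sum_le_sum_of_subset_of_nonneg (fun T hT => Finset.mem_powerset.mpr (Finset.subset_univ _)) fun _ _ _ => sq_nonneg _
  have hStSum : ∑ y ∈ periodBox (d := d) N, ∑ κ : Fin d, ‖St y κ‖ ^ 2 ≤ Osc := by
    rw [Finset.sum_comm, hOsc, Finset.sum_comm (s := periodBox (d := d) N)]
    exact Finset.sum_le_sum fun κ _ => sum_norm_sq_stencilDefect_le hM φ _ κ
  -- assemble
  calc ∑ y ∈ periodBox (d := d) N, ∑ κ : Fin d,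
        ‖cpush M (flatCfg (d := d) (n := n)) (fun z κ' => ((M : ℝ)⁻¹) • interp M (Finset.univ.erase κ') (fun w => φ w κ') z) y κ - φ y κ‖ ^ 2
      ≤ ∑ y ∈ periodBox (d := d) N, ∑ κ : Fin d, (2 * ‖Fr y κ‖ ^ 2 + 2 * ‖St y κ‖ ^ 2) :=
        Finset.sum_le_sum fun y _ => Finset.sum_le_sum fun κ _ => hpt y κ
    _ = 2 * ∑ y ∈ periodBox (d := d) N, ∑ κ : Fin d, ‖Fr y κ‖ ^ 2 + 2 * ∑ y ∈ periodBox (d := d) N, ∑ κ : Fin d, ‖St y κ‖ ^ 2 := by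
        simp only [Finset.sum_add_distrib, Finset.mul_sum]
    _ ≤ 2 * ((d : ℝ) ^ 2 * 2 ^ d * Osc) + 2 * Osc := by linarith
    _ = 2 * ((d : ℝ) ^ 2 * 2 ^ d + 1) * Osc := by ring

end

end Summit.QuantumFields.BalabanUV.T4Continuum.NE7WhitneyLiftDefect
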